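import Literature.Probability.Percolation.CrossingMeetingLineOnce
import Literature.Probability.Percolation.LatticeSymmetry
import Literature.Probability.Percolation.PlanarDuality
import Literature.Probability.Percolation.LatticeWalksGM
import Literature.Probability.Percolation.BondPercolationSymmetry
import Literature.Probability.Percolation.SiteConnectionTools
import Literature.Probability.Percolation.HalfPlaneArmAxisInputs
import HarnessLib

/-!
# Transplant sharpness LXXV — Zhang's single-crossing RSW transported to the two rectangles of the LINE scheme

builds on p205010 (kernel theorem, internal audit signed; external expert review pending).
Status sentence (coordinator 2026-08-20T04:30Z): "θ(p_c) = 0 on ℤ^d, all d ≥ 2 — kernel-verified (Lean 4/Mathlib,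
standard axioms); internal adversarial audit SIGNED 2026-08-20 04:29Z; external expert review pending."

Lane `prim-bschramm`, seat p5 (sharpness); memo `run/shared/lean/prim/bschramm/P5-SHARPNESS.md` §49, row 85 LINE form
(programme "LINE").  This module is CONDITIONAL: its theorem takes the typed Literature statement
`Literature.Probability.Percolation.Zhang1994_crossingMeetingAxisOnce` (Zhang, Ann. Probab. 22 (1994), Remark 2 / (2.42);
not proved in the tree — it needs the Kesten–Zhang strict BK inequality) as a hypothesis.

For `P_{1/2}` on `ℤ²` (which is also the law of the dual configuration of the effective configuration of `G_line` off the
bridges, LXXIII), a centre `c : ℤ` and a scale `n ≥ 5`, the event `Gd[n, c]`: for some abscissa `c-n+1 ≤ x ≤ c+n-1` there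
are an open path from `(x,0)` to the row `3n` inside `{c-n+1 ≤ a ≤ c+n-1, 1 ≤ b ≤ 3n} ∪ {(x,0)}` and an open path from
`(x,-1)` to the row `-3n-1` inside `{c-n+1 ≤ a ≤ c+n-1, -3n-1 ≤ b ≤ -1}` (the two halves of LXXIV's structure; the
bridge `{(x,-1),(x,0)}` is NOT part of the event).

* `zhang_structure_lower` — **`P_{1/2}(Gd[n, c]) ≥ C₄ > 0`** uniformly in `n ≥ 5` and `c`, from the typed fact with
  `k = 4`, `m = n-1`: transport by the lattice automorphism `(a,b) ↦ (b+c, a)` (`transposeIso`, `zdShiftIso`;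
  `bondPercolation_real_preimage_relabel_iso`), removal of the last edge of the lower half at the axis vertex
  (`openConnIn_exists_pred`: the only neighbour of `(x,0)` in the lower region is `(x,-1)`), and clipping of both halves
  at the rows `3n`, `-3n-1` (`exists_openConnIn_le_level`).
-/

noncomputable section

namespace Summit.CriticalPhenomena.PercolationContinuityZ3.Theorems.TransplantSharpness

namespace Line

open Literature.Probability.Percolation Literature.Probability.LatticeModels
open MeasureTheory Set SimpleGraph

local notation3 "box[" A₁ ", " A₂ ", " B₁ ", " B₂ "]" =>
  {v : Site 2 | (A₁ : ℤ) ≤ v 0 ∧ v 0 ≤ (A₂ : ℤ) ∧ (B₁ : ℤ) ≤ v 1 ∧ v 1 ≤ (B₂ : ℤ)}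
local notation3 "Ureg[" n ", " c ", " x "]" => box[(c : ℤ) - n + 1, (c : ℤ) + n - 1, (1 : ℤ), (3 : ℤ) * n] ∪ {![(x : ℤ), 0]}
local notation3 "Lreg[" n ", " c "]" => box[(c : ℤ) - n + 1, (c : ℤ) + n - 1, -((3 : ℤ) * n) - 1, (-1 : ℤ)]
/-- The upper half of the structure at the abscissa `x`. -/
local notation3 "Up[" n ", " c ", " x "]" =>
  {η : BondConfig (Site 2) | ∃ y : Site 2, y 1 = 3 * (n : ℤ) ∧ η ∈ openConnIn Ureg[n, c, x] ![(x : ℤ), 0] y}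
/-- The lower half of the structure at the abscissa `x`. -/
local notation3 "Dn[" n ", " c ", " x "]" =>
  {η : BondConfig (Site 2) | ∃ y : Site 2, y 1 = -(3 * (n : ℤ)) - 1 ∧ η ∈ openConnIn Lreg[n, c] ![(x : ℤ), -1] y}
/-- Zhang's structure at centre `c` (some abscissa of the window carries both halves). -/
local notation3 "Gd[" n ", " c "]" => ⋃ x ∈ Finset.Icc ((c : ℤ) - n + 1) ((c : ℤ) + n - 1), (Up[n, c, x] ∩ Dn[n, c, x])
local notation3 "P½" => bondPercolation (zdGraph 2) half

/-! ### Lattice lemmas -/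

/-- The negative of the second coordinate is `1`-Lipschitz along the edges of `ℤ²` (`HalfPlaneArm.axis_Y_le` for the
reversed edge). [folklore] -/
theorem neg_apply_one_le_of_adj (u v : Site 2) (h : (zdGraph 2).Adj u v) : -v 1 ≤ -u 1 + 1 := by
  have := HalfPlaneArm.axis_Y_le v u h.symm
  omega

/-- **Removing the last edge**: an open path inside `S` from `a` to `v ≠ a` ends with an open edge `{w, v}` from a vertex
`w ∈ S`, `w ∼ v`, joined to `a` inside `S \ {v}`. [folklore] -/
theorem openConnIn_exists_pred {ω : BondConfig (Site 2)} (hω : ω ⊆ (zdGraph 2).edgeSet) {S : Set (Site 2)}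
    {a v : Site 2} (hav : a ≠ v) (h : ω ∈ openConnIn S a v) :
    ∃ w : Site 2, w ∈ S ∧ (zdGraph 2).Adj w v ∧ s(w, v) ∈ ω ∧ ω ∈ openConnIn (S \ {v}) a w := by
  classical
  obtain ⟨p, hpS, hpω⟩ := exists_walk_of_mem_openConnIn hω h
  -- a path (no repeated vertex) with the same endpoints, inside `S`, with open edges
  set q := p.bypass with hq
  have hqS : ∀ z ∈ q.support, z ∈ S := fun z hz => hpS z (p.support_bypass_subset_support hz)
  have hqω : ∀ e ∈ q.edges, e ∈ ω := fun e he => hpω e (p.edges_bypass_subset_edges he)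
  have hqpath : q.IsPath := p.bypass_isPath
  -- its reverse starts at `v` with an edge to some `w`, and the rest avoids `v`
  have hr : q.reverse.IsPath := hqpath.reverse
  have hsuppR : ∀ z ∈ q.reverse.support, z ∈ S := by
    intro z hz; rw [Walk.support_reverse, List.mem_reverse] at hz; exact hqS z hz
  have hedgeR : ∀ e ∈ q.reverse.edges, e ∈ ω := by
    intro e he; rw [Walk.edges_reverse, List.mem_reverse] at he; exact hqω e he
  obtain ⟨w, hadj, r, hr_eq⟩ : ∃ (w : Site 2) (hadj : (zdGraph 2).Adj v w) (r : (zdGraph 2).Walk w a),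
      q.reverse = Walk.cons hadj r := by
    cases hqr : q.reverse with
    | nil => exact absurd rfl hav
    | cons hadj r => exact ⟨_, hadj, r, rfl⟩
  have hrpath : r.IsPath ∧ v ∉ r.support := by
    have := hr; rw [hr_eq, Walk.cons_isPath_iff] at this; exact this
  rw [hr_eq] at hsuppR hedgeR
  refine ⟨w, hsuppR w (by simp), hadj.symm, ?_, ?_⟩
  · rw [Sym2.eq_swap]; exact hedgeR _ (by simp)
  · rw [openConnIn_comm]
    refine mem_openConnIn_of_walk r (fun z hz => ⟨hsuppR z (by simp [hz]), fun hzv => hrpath.2 ?_⟩)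
      fun e he => hedgeR e (by simp [he])
    rw [Set.mem_singleton_iff] at hzv
    exact hzv ▸ hz

/-! ### The transport -/

/-- The lattice automorphism `(a, b) ↦ (b + c, a)`. [folklore] -/
theorem transport_apply (c : ℤ) (v : Site 2) :
    (transposeIso.trans (zdShiftIso ![c, 0])) v = ![v 1 + c, v 0] := by
  ext i
  change (zdShiftIso ![c, 0]) (transposeIso v) i = _
  rw [zdShiftIso_apply, transposeIso_apply]
  fin_cases i <;> simp

/-- **Zhang's crossing, transported**: if `ω` has a left–right open crossing of `[-4m, 4m] × [-m, m]` meeting the `Y` axis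
once (split form), then its image under `(a,b) ↦ (b+c, a)` carries both halves of the structure at some abscissa of
`[c-m, c+m]`, for `m = n - 1`, `n ≥ 5`. [cite: Zhang1994, Remark 2, p. 805] -/
theorem relabel_mem_structure {n : ℕ} (hn : 5 ≤ n) (c : ℤ) {ω : BondConfig (Site 2)} (hω : ω ⊆ (zdGraph 2).edgeSet)
    (h : ω ∈ crossingMeetingAxisOnce 4 (n - 1)) :
    BondConfig.relabel (sym2Equiv (transposeIso.trans (zdShiftIso ![c, 0])).toEquiv) ω ∈ Gd[n, c] := by
  set φ : zdGraph 2 ≃g zdGraph 2 := transposeIso.trans (zdShiftIso ![c, 0]) with hφ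
  set ω' := BondConfig.relabel (sym2Equiv φ.toEquiv) ω with hω'
  have hφv : ∀ v : Site 2, φ v = ![v 1 + c, v 0] := transport_apply c
  have hω'E : ω' ⊆ (zdGraph 2).edgeSet := by
    intro z hz
    rw [hω', BondConfig.relabel_apply] at hz
    obtain ⟨e, he, rfl⟩ := hz
    exact (sym2Equiv_mem_edgeSet_iff φ e).2 (hω he)
  obtain ⟨v, l, r, hv0, hv1, hv2, hl, hl0, hr, hr0, h1, h2⟩ := h
  have hm : ((4 * (n - 1) : ℕ) : ℤ) = 4 * (n : ℤ) - 4 := by push_cast [Nat.cast_sub (by omega : 1 ≤ n)]; ring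
  have hm' : ((n - 1 : ℕ) : ℤ) = (n : ℤ) - 1 := by push_cast [Nat.cast_sub (by omega : 1 ≤ n)]; ring
  set x : ℤ := v 1 + c with hx
  have hxv : φ v = ![x, 0] := by rw [hφv, hv0]
  have hxI : x ∈ Finset.Icc (c - n + 1) (c + n - 1) := by
    rw [Finset.mem_Icc]; rw [hm'] at hv1 hv2; constructor <;> omega
  refine Set.mem_biUnion (Finset.mem_coe.2 hxI) ⟨?_, ?_⟩
  · -- the upper half: image of the right part, clipped at the row `3n`
    have h2' := relabel_mem_openConnIn φ.toEquiv h2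
    rw [show BondConfig.relabel (sym2Equiv φ.toEquiv) ω = ω' from rfl] at h2'
    change ω' ∈ openConnIn (φ '' (rightHalfRect 4 (n - 1) ∪ {v})) (φ v) (φ r) at h2'
    rw [hxv] at h2'
    have hsub : φ '' (rightHalfRect 4 (n - 1) ∪ {v}) ⊆ box[c - n + 1, c + n - 1, (1 : ℤ), 4 * (n : ℤ) - 4] ∪ {![x, 0]} := by
      rintro _ ⟨w, hw, rfl⟩
      rcases hw with hw | hw
      · left
        obtain ⟨a1, a2, a3, a4⟩ := hw
        rw [hm] at a2; rw [hm'] at a3 a4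
        refine ⟨?_, ?_, ?_, ?_⟩ <;> simp only [hφv, Matrix.cons_val_zero, Matrix.cons_val_one] <;> omega
      · right; rw [Set.mem_singleton_iff] at hw ⊢; rw [hw, hxv]
    have h3 := openConnIn_mono hsub _ _ h2'
    have hr1 : (φ r) 1 = 4 * (n : ℤ) - 4 := by rw [hφv]; simp [hr0, hm]
    obtain ⟨z, hz, hconn⟩ := exists_openConnIn_le_level hω'E (fun w : Site 2 => w 1) HalfPlaneArm.axis_Y_le
      (3 * (n : ℤ)) (x := ![x, 0]) (y := φ r) (by simp) (by rw [hr1]; omega) h3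
    refine ⟨z, hz, openConnIn_mono ?_ _ _ hconn⟩
    rintro w ⟨hw | hw, hwle⟩
    · left; obtain ⟨a1, a2, a3, a4⟩ := hw; exact ⟨a1, a2, a3, hwle⟩
    · right; exact hw
  · -- the lower half: image of the left part, last edge removed, clipped at the row `-3n-1`
    have h1' := relabel_mem_openConnIn φ.toEquiv h1
    change ω' ∈ openConnIn (φ '' (leftHalfRect 4 (n - 1) ∪ {v})) (φ l) (φ v) at h1'
    rw [hxv] at h1'
    have hsub : φ '' (leftHalfRect 4 (n - 1) ∪ {v}) ⊆ box[c - n + 1, c + n - 1, -(4 * (n : ℤ) - 4), (-1 : ℤ)] ∪ {![x, 0]} := by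
      rintro _ ⟨w, hw, rfl⟩
      rcases hw with hw | hw
      · left
        obtain ⟨a1, a2, a3, a4⟩ := hw
        rw [hm] at a1; rw [hm'] at a3 a4
        refine ⟨?_, ?_, ?_, ?_⟩ <;> simp only [hφv, Matrix.cons_val_zero, Matrix.cons_val_one] <;> omega
      · right; rw [Set.mem_singleton_iff] at hw ⊢; rw [hw, hxv]
    have h3 := openConnIn_mono hsub _ _ h1'
    have hl1 : (φ l) 1 = -(4 * (n : ℤ) - 4) := by rw [hφv]; simp [hl0, hm]
    have hne : φ l ≠ ![x, 0] := by
      intro he; have := congrFun he 1; rw [hl1] at this; simp at this; omega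
    obtain ⟨w, hwS, hadj, hwe, hconn⟩ := openConnIn_exists_pred hω'E hne h3
    -- the predecessor of `(x,0)` inside the lower region is `(x,-1)`
    have hwL : w ∈ box[c - n + 1, c + n - 1, -(4 * (n : ℤ) - 4), (-1 : ℤ)] := by
      rcases hwS with hw | hw
      · exact hw
      · exact absurd (Set.mem_singleton_iff.1 hw) hadj.ne
    have hw_eq : w = ![x, -1] := by
      rw [zdGraph_adj_iff] at hadj
      obtain ⟨a1, a2, a3, a4⟩ := hwL
      obtain ⟨j, hj | hj⟩ := hadj <;>
      · have e0 := congrFun hj 0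
        have e1 := congrFun hj 1
        ext i
        fin_cases i <;> fin_cases j <;> simp at e0 e1 ⊢ <;> omega
    rw [hw_eq] at hconn
    have hconn' : ω' ∈ openConnIn box[c - n + 1, c + n - 1, -(4 * (n : ℤ) - 4), (-1 : ℤ)] ![x, -1] (φ l) := by
      rw [openConnIn_comm]
      refine openConnIn_mono ?_ _ _ hconn
      rintro u ⟨hu | hu, hne'⟩
      · exact hu
      · exact absurd hu hne'
    obtain ⟨z, hz, hconn2⟩ := exists_openConnIn_le_level hω'E (fun w : Site 2 => -w 1) neg_apply_one_le_of_adj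
      (3 * (n : ℤ) + 1) (x := ![x, -1]) (y := φ l) (by simp) (by rw [hl1]; omega) hconn'
    have hz' : -(z 1) = 3 * (n : ℤ) + 1 := hz
    refine ⟨z, by omega, openConnIn_mono ?_ _ _ hconn2⟩
    rintro u ⟨⟨a1, a2, a3, a4⟩, hule⟩
    simp only [mem_setOf_eq] at hule
    exact ⟨a1, a2, by omega, a4⟩

/-- **Zhang's single-crossing RSW for the LINE scheme**: under the typed fact, `P_{1/2}(Gd[n, c]) ≥ C₄ > 0` for all
`n ≥ 5` and all centres `c`. [cite: Zhang1994, Remark 2, p. 805; (2.42), p. 818] -/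
theorem zhang_structure_lower (hZ : Zhang1994_crossingMeetingAxisOnce) :
    ∃ C : ℝ, 0 < C ∧ ∀ n : ℕ, 5 ≤ n → ∀ c : ℤ, C ≤ (P½).real Gd[n, c] := by
  obtain ⟨C, hC, hbound⟩ := hZ 4 (by norm_num)
  refine ⟨C, hC, fun n hn c => ?_⟩
  have hm : 1 ≤ n - 1 := by omega
  refine (hbound (n - 1) hm).trans ?_
  set φ : zdGraph 2 ≃g zdGraph 2 := transposeIso.trans (zdShiftIso ![c, 0]) with hφ
  -- transport (lattice configurations have full measure), compare
  have hle : (P½).real (crossingMeetingAxisOnce 4 (n - 1)) ≤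
      (P½).real (BondConfig.relabel (sym2Equiv φ.toEquiv) ⁻¹' Gd[n, c]) := by
    rw [measureReal_def, measureReal_def]
    refine ENNReal.toReal_mono (measure_ne_top _ _) (measure_mono_ae ?_)
    filter_upwards [ae_subset_edgeSet (zdGraph 2) half] with ω hE hω
    exact relabel_mem_structure hn c hE hω
  exact hle.trans (le_of_eq (bondPercolation_real_preimage_relabel_iso φ half _))

end Line

end Summit.CriticalPhenomena.PercolationContinuityZ3.Theorems.TransplantSharpness
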